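import Mathlib
import Summits.QuantumFields.QCD.Theses.PauliWegnerSea
import Summits.QuantumFields.QCD.Theorems.PauliWegnerSeaFMClosureUnquenchedHopping
import Summits.QuantumFields.QCD.Theorems.PauliWegnerSeaFMClosureUnquenchedResolvent

/-!
# Line `thick-collar-far-stability` — skeleton for crux `PauliWegnerSea.FMClosureUnquenched` (stmt-QuantumFields-11512)

Crux (fixed, by name): `FMClosureUnquenched = FibreCofactorDomination → TiltedFlatness → Core`, where
`Core = ∀ Nf reg m > 0, Input → Conclusion` is the fractional-moment closure: a ONE-SCALE phase-quenched
shell bound (`Input`, ∀ q with room `ℓ₀^q (1+|β_k|)^q`) implies clause (ii) of `MobilityGap`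
(`Conclusion`: `E_{|w|,k,S}[(Σ|G_f(0,v)|)^s] ≤ C e^{-δ a_k ‖v‖}` for all `S ≥ L_k`, all `v`).

Idea (card `Cruxes/FMClosureUnquenched/Ideas/thick-collar-far-stability.md`, line card
`Cruxes/FMClosureUnquenched/Lines/thick-collar-far-stability.md`): run the
Aizenman–Schenker–Friedrich–Hundertmark bootstrap (arXiv:math-ph/9910022, Lemma 5/6, Thm 2/3) from the
second-order resolvent identity with UNEQUAL depletion sets (the even boxes `W = ebox(x,ℓ)` and
`Λ = ebox(x,3ℓ+2)`); kill the spanning factor by the two-star bound (K1+K3); replace "the expectation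
now factorizes" (ibid. p. 7) by ONE measure property, FAR STABILITY of the Dirichlet-box exit moment
across a collar as thick as the box; convert the typed shell input by the reversed Lemma 6; iterate in
the same domain (the torus).

RESHAPE (lead, cycle 1, 2026-08-16). (i) All depletion regions are `Finset`s of torus sites (ball,
sphere, even box, inner/outer boundary) instead of `Prop`-valued predicates, so that side matrices
`D_A ⊕ 1` are stated with decidable membership and admissibility is plain `Finset` equality.
(ii) The two provable-now stubs are registered in UNFOLDED tree vocabulary — `stub_hopping` with the
crux's own integrand written out, `stub_resolvent` with `let`-bound local abbreviations only — so that
their proofs land as definition-free `Theorems/` files whose statements match the registered text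
verbatim; the packaged predicates `HoppingDecay` / `CollarResolventBounds` are DEFINED as those very
texts, hence the composition consumes the landed theorems by `δ`-unfolding. (iii) The remaining stubs
keep the packaged vocabulary (`TwoStarBounds`, `FarStability`, `UnitShellLowerBound`,
`InwardExtension`, the closure). Composition and stub count (7) unchanged.

WAVE 1 (lead, 2026-08-16): `stub_hopping` CLOSED (p75265, `Theorems/PauliWegnerSeaFMClosureUnquenchedHopping.lean`,
imported below); `stub_resolvent` CLOSED (p77083, `Theorems/PauliWegnerSeaFMClosureUnquenchedResolvent.lean`, imported below);
`stub_twoStar`, `stub_farStability`, `stub_unitShell`, `stub_inward` came back `stub-blocked` with lean-checked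
partial lemmas attached as item evidence (T0-positivity for ALL β/masses/S; RHS-nonnegativity and locality of the
far-stability functionals; the s-free Jensen reduction of the unit-shell bound; the axis-interpolation reduction of the
inward half) and two interface corrections applied here: (iv) `OutwardDecayWith` records `ℓ₀ k f ≤ L_k` (without it
`stub_inward` also asserted decay on whole tori `L_k ≤ S < ℓ₀`, where the outward package is vacuous);
(v) `stub_farStability` is conditional on K1, K3 like `stub_twoStar` (its only junk asymmetry — a non-integrable
inside factor making `pqE[A] = 0` — is exactly (T0), which the line derives from K1 ∧ K3; free in the composition).
-/

noncomputable section

namespace Summit.QuantumFields.QCD.Cruxes.FMClosureUnquenched.ThickCollarFarStability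

open scoped BigOperators
open MeasureTheory Filter
open Literature.MathematicalPhysics.QuantumFieldTheory Literature.MathematicalPhysics.QuantumLattice
  Literature.Probability.LatticeModels

local notation "𝔾" => Matrix.specialUnitaryGroup (Fin 3) ℂ

/-! ## The crux's own quantities (verbatim integrands) -/

/-- Bare Wilson masses of the regularisation at step `k`: `m_f(k) = m_crit(k) + a_k m_f / Z_m(k)`
(verbatim the lambda of the crux). -/
def bareMass {Nf : ℕ} (reg : QCDRegularisation Nf) (m : Fin Nf → ℝ) (k : ℕ) : Fin Nf → ℝ :=
  fun fl => reg.mcrit k + reg.a k * m fl / reg.Zm k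

/-- The crux's phase-quenched two-point fractional moment on the torus of side `2S+1` at coupling `β`
and bare masses `mq`: `E_{|w|}[(Σ_{a,i,b,j} |G_f((0,a,i),(v,b,j))|)^s]`, written EXACTLY as in
`FMClosureUnquenched` (ratio of Bochner integrals against `wilsonMeasure`, weight `‖det diracMatrix‖`). -/
def cruxMoment (Nf : ℕ) (β : ℝ) (mq : Fin Nf → ℝ) (S : ℕ) (f : Fin Nf)
    (v : Literature.Probability.LatticeModels.Site 4) (s : ℝ) : ℝ :=
  (∫ U : GaugeConfig 4 (2 * S + 1) (Matrix.specialUnitaryGroup (Fin 3) ℂ),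
      ‖(diracMatrix U mq).det‖ *
        (∑ a : Fin 3, ∑ i : Fin 4, ∑ b : Fin 3, ∑ j : Fin 4,
          ‖(diracMatrix U mq)⁻¹ (quarkEquiv (f, (Torus.proj (2 * S + 1) 0, a, i)))
            (quarkEquiv (f, (Torus.proj (2 * S + 1) (v), b, j)))‖) ^ s
      ∂(wilsonMeasure (fundamentalRep (Fin 3)) β)) /
    (∫ U : GaugeConfig 4 (2 * S + 1) (Matrix.specialUnitaryGroup (Fin 3) ℂ),
      ‖(diracMatrix U mq).det‖ ∂(wilsonMeasure (fundamentalRep (Fin 3)) β))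

/-- The crux's antecedent (the ONE-SCALE INPUT), verbatim up to the abbreviations above. -/
def Input (Nf : ℕ) (reg : QCDRegularisation Nf) (m : Fin Nf → ℝ) : Prop :=
  ∀ q : ℕ, ∃ K₀ s : ℝ, 0 < s ∧ s < 1 ∧ ∀ᶠ k in atTop, ∃ ℓ₀ : ℕ, 1 ≤ ℓ₀ ∧ ℓ₀ ≤ reg.L k ∧
    (ℓ₀ : ℝ) * reg.a k ≤ K₀ * (1 + |Real.log (reg.a k)|) ∧
    ∀ S : ℕ, reg.L k ≤ S → ∀ (f : Fin Nf) (v : Literature.Probability.LatticeModels.Site 4),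
      v ∈ box 4 S → ‖v‖ = (ℓ₀ : ℝ) →
        (ℓ₀ : ℝ) ^ q * (1 + |reg.β k|) ^ q * cruxMoment Nf (reg.β k) (bareMass reg m k) S f v s ≤ 1

/-- The crux's consequent (clause (ii) of `MobilityGap`), verbatim up to the abbreviations above. -/
def Conclusion (Nf : ℕ) (reg : QCDRegularisation Nf) (m : Fin Nf → ℝ) : Prop :=
  ∃ s δ C : ℝ, 0 < s ∧ s < 1 ∧ 0 < δ ∧ ∀ᶠ k in atTop, ∀ S : ℕ, reg.L k ≤ S →
    ∀ (f : Fin Nf) (v : Literature.Probability.LatticeModels.Site 4), v ∈ box 4 S →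
      cruxMoment Nf (reg.β k) (bareMass reg m k) S f v s ≤ C * Real.exp (-(δ * (reg.a k * ‖v‖)))

/-- The crux is literally `K1 → K3 → ∀ Nf reg m > 0, Input → Conclusion` (definitional unfolding;
cf. the standing disprover's `fmClosure_iff`). -/
theorem crux_iff :
    Summit.QuantumFields.QCD.Theses.PauliWegnerSea.FMClosureUnquenched ↔
      (Summit.QuantumFields.QCD.Theses.PauliWegnerSea.FibreCofactorDomination →
        Summit.QuantumFields.QCD.Theses.PauliWegnerSea.TiltedFlatness →
          ∀ (Nf : ℕ) (reg : QCDRegularisation Nf) (m : Fin Nf → ℝ), (∀ f, 0 < m f) →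
            Input Nf reg m → Conclusion Nf reg m) :=
  Iff.rfl

/-! ## Internal vocabulary of the line (single-flavour Green functions, side-wise depletions, boxes) -/

/-- Quark index of ONE flavour on the torus of side `N`: site × colour × spin (the index type of the
tree's `wilsonDirac` for `SU(3)`). -/
abbrev QIdx (N : ℕ) : Type := TorusSite 4 N × Fin 3 × Fin 4

/-- `ℓ¹` block norm of the `(x,y)` colour–spin block of a one-flavour quark matrix:
`Σ_{a,i,b,j} |M_{(x,a,i),(y,b,j)}|` (the quantity under the power `s` in the crux). -/
def blockNorm {N : ℕ} (M : Matrix (QIdx N) (QIdx N) ℂ) (x y : TorusSite 4 N) : ℝ :=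
  ∑ a : Fin 3, ∑ i : Fin 4, ∑ b : Fin 3, ∑ j : Fin 4, ‖M (x, a, i) (y, b, j)‖

/-- The side matrix `M_A ⊕ 1` of a finite set `A` of sites: agrees with `M` between two sites of `A`
and is the identity elsewhere (ASFH's "turning off the hopping terms across `∂A`",
arXiv:math-ph/9910022 §2.a, in a form whose inverse never produces junk on the other side). -/
def sideMatrix {N : ℕ} [NeZero N] (A : Finset (TorusSite 4 N)) (M : Matrix (QIdx N) (QIdx N) ℂ) :
    Matrix (QIdx N) (QIdx N) ℂ :=
  Matrix.of fun p q => if p.1 ∈ A ∧ q.1 ∈ A then M p q else if p = q then 1 else 0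

/-- SIDE-WISE Dirichlet Green function of the site set `A` (ASFH's `G_Ω`, `Ω = A`): the inverse of
`sideMatrix A M`; its `A × A` blocks are those of `M_A⁻¹`. -/
def gside {N : ℕ} [NeZero N] (A : Finset (TorusSite 4 N)) (M : Matrix (QIdx N) (QIdx N) ℂ) :
    Matrix (QIdx N) (QIdx N) ℂ :=
  (sideMatrix A M)⁻¹

/-- The (odd, centred) sup-ball of radius `r` about `x` on the torus of side `2S+1`
(`z = x + w (mod 2S+1)`, `w ∈ {-r,…,r}⁴`; faithful for `r ≤ S`). Used only through its COMPLEMENT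
(forward steps): the inside of an odd ball is bipartite-unbalanced. -/
def ball (S : ℕ) (x : TorusSite 4 (2 * S + 1)) (r : ℕ) : Finset (TorusSite 4 (2 * S + 1)) :=
  (box 4 r).image fun w => x + Torus.proj (2 * S + 1) w

/-- The sup-sphere of radius `r` about `x` (inner boundary of the odd ball; the typed input lives on
the sphere of radius `ℓ₀` about `0`): offsets `w ∈ box r` with a coordinate equal to `±r`. -/
def sphere (S : ℕ) (x : TorusSite 4 (2 * S + 1)) (r : ℕ) : Finset (TorusSite 4 (2 * S + 1)) :=
  ((box 4 r).filter fun w : Literature.Probability.LatticeModels.Site 4 =>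
      ∃ i, w i = (r : ℤ) ∨ w i = -(r : ℤ)).image
    fun w => x + Torus.proj (2 * S + 1) w

/-- The EVEN box of "radius" `r` about `x`: offsets `w ∈ {-r-1,…,r}⁴` (side `2r+2`,
bipartite-balanced, so no parity obstruction to invertibility at any bare mass). The boxes
`W = ebox(x,ℓ)` and `Λ = ebox(x,3ℓ+2)` are the two depletion sets of the thick collar. -/
def ebox (S : ℕ) (x : TorusSite 4 (2 * S + 1)) (r : ℕ) : Finset (TorusSite 4 (2 * S + 1)) :=
  (Fintype.piFinset fun _ : Fin 4 => Finset.Icc (-(r : ℤ) - 1) r).image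
    fun w => x + Torus.proj (2 * S + 1) w

/-- Inner boundary of the even box of radius `r` about `x` (offsets with a coordinate in `{-r-1, r}`). -/
def boxIn (S : ℕ) (x : TorusSite 4 (2 * S + 1)) (r : ℕ) : Finset (TorusSite 4 (2 * S + 1)) :=
  ((Fintype.piFinset fun _ : Fin 4 => Finset.Icc (-(r : ℤ) - 1) r).filter
      fun w : Literature.Probability.LatticeModels.Site 4 =>
        ∃ i, w i = -(r : ℤ) - 1 ∨ w i = (r : ℤ)).image
    fun w => x + Torus.proj (2 * S + 1) w

/-- Outer boundary of the even box of radius `r` about `x` (offsets in `{-r-2,…,r+1}⁴` with a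
coordinate in `{-r-2, r+1}`). -/
def boxOut (S : ℕ) (x : TorusSite 4 (2 * S + 1)) (r : ℕ) : Finset (TorusSite 4 (2 * S + 1)) :=
  ((Fintype.piFinset fun _ : Fin 4 => Finset.Icc (-(r : ℤ) - 2) (r + 1)).filter
      fun w : Literature.Probability.LatticeModels.Site 4 =>
        ∃ i, w i = -(r : ℤ) - 2 ∨ w i = (r : ℤ) + 1).image
    fun w => x + Torus.proj (2 * S + 1) w

/-- The one-flavour Wilson–Dirac matrix (`r = 1`, fundamental `SU(3)`) at bare mass `m₀`. -/
def wilsonD {N : ℕ} [NeZero N] (U : GaugeConfig 4 N 𝔾) (m₀ : ℝ) : Matrix (QIdx N) (QIdx N) ℂ :=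
  wilsonDirac (fundamentalRep (Fin 3)) U m₀ 1

/-- Phase-quenched expectation `E_{|w|}[F] = ∫ ‖det D(U)‖ F(U) dμ_W(β) / ∫ ‖det D(U)‖ dμ_W(β)` on the
torus of side `2S+1`, with the MULTI-flavour weight `‖det diracMatrix U mq‖` of the crux (ratio of
Bochner integrals, same junk conventions as the crux; equals the tree's `qcdPhaseQuenchedExpect`). -/
def pqE (Nf S : ℕ) (β : ℝ) (mq : Fin Nf → ℝ)
    (F : GaugeConfig 4 (2 * S + 1) 𝔾 → ℝ) : ℝ :=
  (∫ U : GaugeConfig 4 (2 * S + 1) (Matrix.specialUnitaryGroup (Fin 3) ℂ),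
      ‖(diracMatrix U mq).det‖ * F U ∂(wilsonMeasure (fundamentalRep (Fin 3)) β)) /
    (∫ U : GaugeConfig 4 (2 * S + 1) (Matrix.specialUnitaryGroup (Fin 3) ℂ),
      ‖(diracMatrix U mq).det‖ ∂(wilsonMeasure (fundamentalRep (Fin 3)) β))

/-- The side sets the bootstrap depletes along: the whole torus, an even box, the complement of an
even box, the complement of an odd ball (radius `r ≥ 1`, `r + 1 ≤ S`, so that the ball, its cut
and the first exterior shell are faithful on the torus of side `2S+1`). Plain `Finset` equalities. -/
def AdmissibleSide (S : ℕ) (A : Finset (TorusSite 4 (2 * S + 1))) : Prop :=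
  A = Finset.univ ∨
    ∃ (x : TorusSite 4 (2 * S + 1)) (r : ℕ), 1 ≤ r ∧ r + 1 ≤ S ∧
      (A = ebox S x r ∨ A = (ebox S x r)ᶜ ∨ A = (ball S x r)ᶜ)

/-! ## Stub predicates -/

/-- **Two-star bounds** (card: "FibreLemmas" — K1 in local form, K3 for depleted determinants, the
fibre `R₂` decoupling; A7), stated in the AVERAGED forms the thick-collar bootstrap consumes, with one
constant `Ξ = C (1+|β|)^p (1+radius)^p` uniform in the volume `S`, the outside field (integrated, not
frozen), the probe flavour's mass `m_f ∈ [-9,1]` and ALL other flavours' masses (they only tilt the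
weight), for every `0 < s ≤ s₀`:
* (T0) the weight has positive mass and the (≤ 3)-fold products of `s`-powers of block norms of
  side-wise Green functions of admissible sides are integrable against it (no Bochner junk below);
* (T5) a-priori bound `E‖G(x,y)‖^s ≤ C(1+|β|)^p` (ASFH Lemma 4);
* (Tdec) a DEPLETED factor living on one admissible side can be replaced by `Ξ_r` against one full
  Green-function factor (ASFH Lemma 6 / App. decoupling);
* (T1) spanning-factor removal: in the second-order identity the middle FULL factor `‖G(u',v)‖^s`
  between the two cuts (`u', v ∈ Λ ∖ W`, `W = ebox(x,ℓ)`, `Λ = ebox(x,3ℓ+2)`) can be replaced by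
  `Ξ_ℓ` against the product of the inside factor `‖G_W(x,u)‖^s` and the far factor `‖G_{Λᶜ}(v',y)‖^s`
  (ASFH Lemma 5, eq. (2.17), conditional form, here averaged).
Why averaged and not ess-sup: the ess-sup two-star conditional moment is NOT volume-uniform (tuned
in-window modes, rattack A7); under the measure such conspiracies cost probability. -/
def TwoStarBounds (Nf : ℕ) : Prop :=
  ∃ s₀ C p : ℝ, 0 < s₀ ∧ s₀ < 1 ∧ 0 < C ∧ ∀ s : ℝ, 0 < s → s ≤ s₀ →
  ∀ (β : ℝ) (mq : Fin Nf → ℝ) (f : Fin Nf), -9 ≤ mq f → mq f ≤ 1 → ∀ (S : ℕ),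
    -- (T0) no junk: positive mass of the weight, integrability of the functionals used
    (0 < ∫ U : GaugeConfig 4 (2 * S + 1) (Matrix.specialUnitaryGroup (Fin 3) ℂ),
        ‖(diracMatrix U mq).det‖ ∂(wilsonMeasure (fundamentalRep (Fin 3)) β)) ∧
    (∀ (s₁ s₂ s₃ : ℝ), 0 ≤ s₁ → s₁ ≤ s₀ → 0 ≤ s₂ → s₂ ≤ s₀ → 0 ≤ s₃ → s₃ ≤ s₀ →
      ∀ (A₁ A₂ A₃ : Finset (TorusSite 4 (2 * S + 1))),
        AdmissibleSide S A₁ → AdmissibleSide S A₂ → AdmissibleSide S A₃ →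
      ∀ (a₁ b₁ a₂ b₂ a₃ b₃ : TorusSite 4 (2 * S + 1)),
      Integrable (fun U : GaugeConfig 4 (2 * S + 1) (Matrix.specialUnitaryGroup (Fin 3) ℂ) =>
        ‖(diracMatrix U mq).det‖ *
          (blockNorm (gside A₁ (wilsonD U (mq f))) a₁ b₁ ^ s₁ *
            blockNorm (gside A₂ (wilsonD U (mq f))) a₂ b₂ ^ s₂ *
            blockNorm (gside A₃ (wilsonD U (mq f))) a₃ b₃ ^ s₃))
        (wilsonMeasure (fundamentalRep (Fin 3)) β)) ∧
    -- (T5) a-priori fractional-moment bound, uniform in the volume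
    (∀ x y : TorusSite 4 (2 * S + 1),
      pqE Nf S β mq (fun U => blockNorm (wilsonD U (mq f))⁻¹ x y ^ s) ≤ C * (1 + |β|) ^ p) ∧
    -- (Tdec) a depleted factor on an admissible side is replaced by Ξ_r against a full factor
    (∀ (x : TorusSite 4 (2 * S + 1)) (r : ℕ), 1 ≤ r → r + 1 ≤ S →
      ∀ (A : Finset (TorusSite 4 (2 * S + 1))),
        (A = ebox S x r ∨ A = (ebox S x r)ᶜ ∨ A = (ball S x r)ᶜ) →
      ∀ a b c d : TorusSite 4 (2 * S + 1), a ∈ A → b ∈ A →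
        pqE Nf S β mq (fun U =>
            blockNorm (gside A (wilsonD U (mq f))) a b ^ s * blockNorm (wilsonD U (mq f))⁻¹ c d ^ s) ≤
          C * (1 + |β|) ^ p * (1 + (r : ℝ)) ^ p *
            pqE Nf S β mq (fun U => blockNorm (wilsonD U (mq f))⁻¹ c d ^ s)) ∧
    -- (T1) spanning-factor removal between the two cuts of the thick collar
    (∀ (x : TorusSite 4 (2 * S + 1)) (ℓ : ℕ), 1 ≤ ℓ → 3 * ℓ + 4 ≤ S →
      ∀ u u' v v' y : TorusSite 4 (2 * S + 1),
        u' ∈ ebox S x (3 * ℓ + 2) → u' ∉ ebox S x ℓ → v ∈ ebox S x (3 * ℓ + 2) → v ∉ ebox S x ℓ →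
        v' ∉ ebox S x (3 * ℓ + 2) → y ∉ ebox S x (3 * ℓ + 2) →
          pqE Nf S β mq (fun U =>
              blockNorm (gside (ebox S x ℓ) (wilsonD U (mq f))) x u ^ s *
                blockNorm (wilsonD U (mq f))⁻¹ u' v ^ s *
                blockNorm (gside (ebox S x (3 * ℓ + 2))ᶜ (wilsonD U (mq f))) v' y ^ s) ≤
            C * (1 + |β|) ^ p * (1 + (ℓ : ℝ)) ^ p *
              pqE Nf S β mq (fun U =>
                blockNorm (gside (ebox S x ℓ) (wilsonD U (mq f))) x u ^ s *
                  blockNorm (gside (ebox S x (3 * ℓ + 2))ᶜ (wilsonD U (mq f))) v' y ^ s))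

/-- **Far stability of the exit moment across a thick collar** — THE LOAD-BEARING STUB (card's
`ExitMomentFarStability`, sharpened by triage): for the inside factor `A = ‖G_W(x,u)‖^s`
(`W = ebox(x,ℓ)`, measurable in the links of `W`) and the FAR factor the bootstrap actually
produces, `Ψ = ‖G_{Λᶜ}(v',y)‖^s` (`Λ = ebox(x,3ℓ+2)`, measurable in the links outside `Λ`),
separated by the integrated collar `Λ ∖ W` of width `> 2ℓ`:
`E[A Ψ] ≤ R · ((E A)^θ + E A) · E Ψ`, `R = C(1+|β|)^p(1+ℓ)^p`, some `θ ∈ (0,1]`,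
uniformly in `S`, `y` (arbitrarily far), the masses as in `TwoStarBounds`, `0 < s ≤ s₀`.
Power form of the card's `∀ K ≥ 0: ≤ R(e^K E A + e^{-K/C}) E Ψ`, POLYNOMIAL in `1+|β|`, and for the
SPECIFIC far functional (the ess-sup form is false at weak coupling). It replaces "the expectation
now factorizes" (ASFH p. 7) and is the only place where the non-product structure of
`ν = ‖det‖·μ_W` enters. -/
def FarStability (Nf : ℕ) : Prop :=
  ∃ s₀ C p θ : ℝ, 0 < s₀ ∧ s₀ < 1 ∧ 0 < C ∧ 0 < θ ∧ θ ≤ 1 ∧ ∀ s : ℝ, 0 < s → s ≤ s₀ →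
  ∀ (β : ℝ) (mq : Fin Nf → ℝ) (f : Fin Nf), -9 ≤ mq f → mq f ≤ 1 →
  ∀ (S : ℕ) (x : TorusSite 4 (2 * S + 1)) (ℓ : ℕ), 1 ≤ ℓ → 3 * ℓ + 4 ≤ S →
  ∀ u v' y : TorusSite 4 (2 * S + 1),
    u ∈ ebox S x ℓ → v' ∉ ebox S x (3 * ℓ + 2) → y ∉ ebox S x (3 * ℓ + 2) →
    pqE Nf S β mq (fun U =>
        blockNorm (gside (ebox S x ℓ) (wilsonD U (mq f))) x u ^ s *
          blockNorm (gside (ebox S x (3 * ℓ + 2))ᶜ (wilsonD U (mq f))) v' y ^ s) ≤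
      C * (1 + |β|) ^ p * (1 + (ℓ : ℝ)) ^ p *
        (pqE Nf S β mq (fun U => blockNorm (gside (ebox S x ℓ) (wilsonD U (mq f))) x u ^ s) ^ θ +
          pqE Nf S β mq (fun U => blockNorm (gside (ebox S x ℓ) (wilsonD U (mq f))) x u ^ s)) *
        pqE Nf S β mq (fun U =>
          blockNorm (gside (ebox S x (3 * ℓ + 2))ᶜ (wilsonD U (mq f))) v' y ^ s)

/-- **Collar resolvent bounds** (deterministic matrix algebra, configuration by configuration;
ASFH eqs. (2.11)–(2.16) in `ℓ¹`-block-norm form for the one-flavour Wilson–Dirac matrix with its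
nearest-neighbour hops, `cT` = an absolute bound on the entries of one hop `½(1∓γ_μ)⊗U`).
REGISTERED IN UNFOLDED VOCABULARY: the `let`s below are, in order, `wilsonD U m₀`, `blockNorm`,
`sideMatrix · (wilsonD U m₀)` (so `(side A)⁻¹ = gside A (wilsonD U m₀)`), `ball S x`, `sphere S x`,
`ebox S x`, `boxIn S x`, `boxOut S x` — definitionally. With `D = wilsonD U m₀`, `G = D⁻¹`, the side
matrices `N_A = D_A ⊕ 1` and their inverses:
* (Rfwd) `G = N⁻¹ + G (N - D) N⁻¹` for `N =` the side matrix of the COMPLEMENT of the odd ball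
  `B(x,r)`, read at `(x,z)`, `z ∉ B(x,r)`: the entrance from the input sphere of radius `r` to any
  exterior point (support of `N - D` on rows of the ball: the cut hops `sphere r × sphere (r+1)`);
* (Rin)  `N_W⁻¹ = G + G (D - N_W) N_W⁻¹` read at `(x,u)`, `u ∈ W = ebox(x,ℓ)` (reversed Lemma 6);
* (Rout) `N⁻¹ = G + N⁻¹ (D - N) G` for the complement side of `Λ = ebox(x,3ℓ+2)` read at `(v',y)`;
* (R2)   the second-order identity with `Γ₁ = Γ(W) ≠ Γ₂ = Γ(Λ)` read at `(x,y)`, `y ∉ Λ`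
  ("the depletion sets need not coincide", p. 6): only the spanning diagram survives.
The invertibility hypotheses are genuine (`Matrix.inv` is junk `0` at singular matrices) and
concern only the sides actually inverted; where `D` itself is singular the bounded quantity is the
junk `0` and the inequality is trivial. -/
def CollarResolventBounds : Prop :=
  ∃ cT : ℝ, 0 < cT ∧ ∀ (S : ℕ) (U : GaugeConfig 4 (2 * S + 1) (Matrix.specialUnitaryGroup (Fin 3) ℂ))
      (m₀ : ℝ) (x : TorusSite 4 (2 * S + 1)),
      let D : Matrix (TorusSite 4 (2 * S + 1) × Fin 3 × Fin 4) (TorusSite 4 (2 * S + 1) × Fin 3 × Fin 4) ℂ :=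
        wilsonDirac (fundamentalRep (Fin 3)) U m₀ 1
      let bn : Matrix (TorusSite 4 (2 * S + 1) × Fin 3 × Fin 4) (TorusSite 4 (2 * S + 1) × Fin 3 × Fin 4) ℂ →
          TorusSite 4 (2 * S + 1) → TorusSite 4 (2 * S + 1) → ℝ :=
        fun M y z => ∑ a : Fin 3, ∑ i : Fin 4, ∑ b : Fin 3, ∑ j : Fin 4, ‖M (y, a, i) (z, b, j)‖
      let side : Finset (TorusSite 4 (2 * S + 1)) →
          Matrix (TorusSite 4 (2 * S + 1) × Fin 3 × Fin 4) (TorusSite 4 (2 * S + 1) × Fin 3 × Fin 4) ℂ :=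
        fun A => Matrix.of fun p q => if p.1 ∈ A ∧ q.1 ∈ A then D p q else if p = q then 1 else 0
      let ball : ℕ → Finset (TorusSite 4 (2 * S + 1)) := fun r =>
        (box 4 r).image fun w => x + Torus.proj (2 * S + 1) w
      let sphere : ℕ → Finset (TorusSite 4 (2 * S + 1)) := fun r =>
        ((box 4 r).filter fun w : Literature.Probability.LatticeModels.Site 4 =>
            ∃ i, w i = (r : ℤ) ∨ w i = -(r : ℤ)).image
          fun w => x + Torus.proj (2 * S + 1) w
      let ebox : ℕ → Finset (TorusSite 4 (2 * S + 1)) := fun r =>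
        (Fintype.piFinset fun _ : Fin 4 => Finset.Icc (-(r : ℤ) - 1) r).image
          fun w => x + Torus.proj (2 * S + 1) w
      let boxIn : ℕ → Finset (TorusSite 4 (2 * S + 1)) := fun r =>
        ((Fintype.piFinset fun _ : Fin 4 => Finset.Icc (-(r : ℤ) - 1) r).filter
            fun w : Literature.Probability.LatticeModels.Site 4 =>
              ∃ i, w i = -(r : ℤ) - 1 ∨ w i = (r : ℤ)).image
          fun w => x + Torus.proj (2 * S + 1) w
      let boxOut : ℕ → Finset (TorusSite 4 (2 * S + 1)) := fun r =>
        ((Fintype.piFinset fun _ : Fin 4 => Finset.Icc (-(r : ℤ) - 2) (r + 1)).filter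
            fun w : Literature.Probability.LatticeModels.Site 4 =>
              ∃ i, w i = -(r : ℤ) - 2 ∨ w i = (r : ℤ) + 1).image
          fun w => x + Torus.proj (2 * S + 1) w
      (∀ r : ℕ, 1 ≤ r → r + 1 ≤ S → ∀ z : TorusSite 4 (2 * S + 1), z ∉ ball r →
        (side ((ball r)ᶜ)).det ≠ 0 →
          bn D⁻¹ x z ≤
            cT * ∑ p ∈ sphere r, ∑ p' ∈ sphere (r + 1), bn D⁻¹ x p * bn (side ((ball r)ᶜ))⁻¹ p' z) ∧
      ∀ ℓ : ℕ, 1 ≤ ℓ → ℓ + 2 ≤ S →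
        (∀ u : TorusSite 4 (2 * S + 1), u ∈ ebox ℓ → D.det ≠ 0 →
          bn (side (ebox ℓ))⁻¹ x u ≤
            bn D⁻¹ x u +
              cT * ∑ w' ∈ boxOut ℓ, ∑ w ∈ boxIn ℓ, bn D⁻¹ x w' * bn (side (ebox ℓ))⁻¹ w u) ∧
        (3 * ℓ + 4 ≤ S →
          (∀ v' y : TorusSite 4 (2 * S + 1), v' ∉ ebox (3 * ℓ + 2) → y ∉ ebox (3 * ℓ + 2) →
            D.det ≠ 0 →
              bn (side ((ebox (3 * ℓ + 2))ᶜ))⁻¹ v' y ≤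
                bn D⁻¹ v' y +
                  cT * ∑ w' ∈ boxOut (3 * ℓ + 2), ∑ w ∈ boxIn (3 * ℓ + 2),
                    bn (side ((ebox (3 * ℓ + 2))ᶜ))⁻¹ v' w' * bn D⁻¹ w y) ∧
          (∀ y : TorusSite 4 (2 * S + 1), y ∉ ebox (3 * ℓ + 2) →
            (side (ebox ℓ)).det ≠ 0 → (side ((ebox (3 * ℓ + 2))ᶜ)).det ≠ 0 →
              bn D⁻¹ x y ≤
                cT ^ 2 * ∑ u ∈ boxIn ℓ, ∑ u' ∈ boxOut ℓ,
                  ∑ v ∈ boxIn (3 * ℓ + 2), ∑ v' ∈ boxOut (3 * ℓ + 2),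
                    bn (side (ebox ℓ))⁻¹ x u * bn D⁻¹ u' v *
                      bn (side ((ebox (3 * ℓ + 2))ᶜ))⁻¹ v' y))

/-- **Unit-shell lower bound** (the refuters' A5 corner `ℓ₀ = 1`, `β_k → 0`, made vacuous; card §(vi),
toy j006913: at `β = 0` the quenched `E log Σ|G(0,e_μ)|` is `+0.22` at `κ = 1/8` and crosses `0` only at
`κ* ≈ 0.113`, i.e. `m₀ ≈ 0.42`): there are `β₀ > 0` and `S₀` such that for `|β| ≤ β₀`, probe mass in the
non-hopping window `m_f ∈ [-8.1, 0.1]` (other masses arbitrary), side `≥ 2S₀+1` and EVERY `s ∈ (0,1)`,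
some unit-shell vector `v` (`‖v‖∞ = 1`) has phase-quenched moment `> 1` — so the typed input
`1^q (1+|β|)^q E ≤ 1` cannot hold at `ℓ₀ = 1` there. By Jensen it suffices that
`E_{|w|} log Σ|G_f(0,v)| > 0`; margins are thin near `m_f = 0.1`. -/
def UnitShellLowerBound (Nf : ℕ) : Prop :=
  ∃ β₀ : ℝ, 0 < β₀ ∧ ∃ S₀ : ℕ, ∀ β : ℝ, |β| ≤ β₀ → ∀ (mq : Fin Nf → ℝ) (f : Fin Nf),
    -(81 / 10 : ℝ) ≤ mq f → mq f ≤ 1 / 10 → ∀ S : ℕ, S₀ ≤ S → ∀ s : ℝ, 0 < s → s < 1 →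
      ∃ v : Literature.Probability.LatticeModels.Site 4, v ∈ box 4 S ∧ ‖v‖ = (1 : ℝ) ∧
        1 < cruxMoment Nf β mq S f v s

/-- **Hopping decay** (heavy and negative-heavy probe mass `|m_f + 4| ≥ 4.1`, every `β`, every
background; provable now): `wilsonDirac U m₀ 1 = (m₀+4)·1 - Σ_μ W_μ` with `‖W_μ‖₂ ≤ 1`
(tree `wilsonDirac_eq_sub_sum_wilsonHop`, `l2_opNorm_wilsonHop_le`), so
`HoppingExpansionLocality_holds` (`isHoppingNorm_l2OpNorm`) gives
`|G_{xy}| ≤ θ^{dist}/((1-θ)|m₀+4|)`, `θ = 4/4.1`, configuration-wise; integrate the `s`-th power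
against the normalised phase-quenched weight (torus distance `≥ ‖v‖∞` for `v ∈ box S`; the heavy
positive-mass half is the tree's `phaseQuenched_fractionalMoment_decay_of_heavy` pattern).
REGISTERED IN UNFOLDED VOCABULARY: the quotient below is `cruxMoment Nf β mq S f v s` verbatim. -/
def HoppingDecay (Nf : ℕ) : Prop :=
  ∃ C μ : ℝ, 0 ≤ C ∧ 0 < μ ∧ ∀ (β : ℝ) (mq : Fin Nf → ℝ) (f : Fin Nf), (41 / 10 : ℝ) ≤ |mq f + 4| →
      ∀ (S : ℕ) (s : ℝ), 0 < s → s < 1 →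
        ∀ v : Literature.Probability.LatticeModels.Site 4, v ∈ box 4 S →
          (∫ U : GaugeConfig 4 (2 * S + 1) (Matrix.specialUnitaryGroup (Fin 3) ℂ),
              ‖(diracMatrix U mq).det‖ *
                (∑ a : Fin 3, ∑ i : Fin 4, ∑ b : Fin 3, ∑ j : Fin 4,
                  ‖(diracMatrix U mq)⁻¹ (quarkEquiv (f, (Torus.proj (2 * S + 1) 0, a, i)))
                    (quarkEquiv (f, (Torus.proj (2 * S + 1) (v), b, j)))‖) ^ s
              ∂(wilsonMeasure (fundamentalRep (Fin 3)) β)) /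
            (∫ U : GaugeConfig 4 (2 * S + 1) (Matrix.specialUnitaryGroup (Fin 3) ℂ),
              ‖(diracMatrix U mq).det‖ ∂(wilsonMeasure (fundamentalRep (Fin 3)) β)) ≤
          C * Real.exp (-(μ * s * ‖v‖))

/-- Outward decay package produced by the bootstrap: decay at physical rate `δ a_k` for
`‖v‖∞ ≥ ℓ₀(k,f)`, k-uniform constant, with the outward radius inside the log-scale window
`ℓ₀(k,f) a_k ≤ K₀(1+|log a_k|)` of the typed input AND inside the torus, `ℓ₀(k,f) ≤ L_k` (reshape (iv);
`ℓ₀(k,f) = 0` on steps/flavours where the closure already has decay everywhere, e.g. the hopping window). -/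
def OutwardDecayWith (Nf : ℕ) (reg : QCDRegularisation Nf) (m : Fin Nf → ℝ)
    (s δ C K₀ : ℝ) (ℓ₀ : ℕ → Fin Nf → ℕ) : Prop :=
  0 < s ∧ s < 1 ∧ 0 < δ ∧ 0 ≤ C ∧
  (∀ᶠ k in atTop, ∀ f : Fin Nf, (ℓ₀ k f : ℝ) * reg.a k ≤ K₀ * (1 + |Real.log (reg.a k)|)) ∧
  (∀ᶠ k in atTop, ∀ f : Fin Nf, ℓ₀ k f ≤ reg.L k) ∧
  ∀ᶠ k in atTop, ∀ S : ℕ, reg.L k ≤ S →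
    ∀ (f : Fin Nf) (v : Literature.Probability.LatticeModels.Site 4), v ∈ box 4 S → (ℓ₀ k f : ℝ) ≤ ‖v‖ →
      cruxMoment Nf (reg.β k) (bareMass reg m k) S f v s ≤ C * Real.exp (-(δ * (reg.a k * ‖v‖)))

/-- Inward decay package: the complementary region `‖v‖∞ < ℓ₀(k,f)` at the SAME exponent `s`. -/
def InwardDecayWith (Nf : ℕ) (reg : QCDRegularisation Nf) (m : Fin Nf → ℝ)
    (s δ' C' : ℝ) (ℓ₀ : ℕ → Fin Nf → ℕ) : Prop :=
  0 < δ' ∧ 0 ≤ C' ∧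
  ∀ᶠ k in atTop, ∀ S : ℕ, reg.L k ≤ S →
    ∀ (f : Fin Nf) (v : Literature.Probability.LatticeModels.Site 4), v ∈ box 4 S → ‖v‖ < (ℓ₀ k f : ℝ) →
      cruxMoment Nf (reg.β k) (bareMass reg m k) S f v s ≤ C' * Real.exp (-(δ' * (reg.a k * ‖v‖)))

/-- **Inward extension** (refuters' A6 = BarrierNotes B0 + the k-uniform short-distance bound A7;
NOT this idea's mechanism — the complementary half every outward line must carry): given the
two-star bounds, the typed input and the outward package, decay holds inside the outward radius
too. Mechanism known only on the even-`N_f`, pairwise-degenerate, `m_f > -1` locus (Lüscher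
transfer-matrix positivity in the antiperiodic auxiliary theory); OPEN for odd `N_f` — if it dies,
the crux is restated to `‖v‖∞ ≥ ℓ₀(k)` (A6 repair) and this stub disappears. -/
def InwardExtension (Nf : ℕ) (reg : QCDRegularisation Nf) (m : Fin Nf → ℝ) : Prop :=
  TwoStarBounds Nf → Input Nf reg m →
    ∀ (s δ C K₀ : ℝ) (ℓ₀ : ℕ → Fin Nf → ℕ), OutwardDecayWith Nf reg m s δ C K₀ ℓ₀ →
      ∃ δ' C' : ℝ, InwardDecayWith Nf reg m s δ' C' ℓ₀

/-! ## Registered stubs -/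

/-- stub 1 (L; fibre harmonic analysis — this is where the crux's hypotheses K1 and K3 are USED:
K1 local form + K3-type relative small balls for one depleted factor under the product-tilted
two-star law + the fibre `R₂` decoupling of Elgart–Shamis–Sodin type; then "no conspiracy under
size-bias" to integrate the outside field). -/
theorem stub_twoStar :
    Summit.QuantumFields.QCD.Theses.PauliWegnerSea.FibreCofactorDomination →
      Summit.QuantumFields.QCD.Theses.PauliWegnerSea.TiltedFlatness →
        ∀ Nf : ℕ, TwoStarBounds Nf := by
  sorry

/-- stub 2 (XL, HARDEST; the one property of the phase-quenched gauge measure replacing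
independence). Provable corners: `N_f = 0` at `β = 0` (product Haar), strong coupling / heavy sea
by the convergent cluster expansion. -/
theorem stub_farStability :
    Summit.QuantumFields.QCD.Theses.PauliWegnerSea.FibreCofactorDomination →
      Summit.QuantumFields.QCD.Theses.PauliWegnerSea.TiltedFlatness →
        ∀ Nf : ℕ, FarStability Nf := by
  sorry

/-- stub 3 — CLOSED (landed p77083, `Theorems/PauliWegnerSeaFMClosureUnquenchedResolvent.lean`, 399 lines,
`cT = 4`: resolvent identities `M⁻¹ - N⁻¹ = N⁻¹ (N - M) M⁻¹ = M⁻¹ (N - M) N⁻¹`, block-diagonality of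
`(D_A ⊕ 1)⁻¹`, support of the cross-cut hops on adjacent boundary pairs, expand-and-bound). Registered in
unfolded vocabulary (= `CollarResolventBounds` verbatim); the skeleton now imports the landed theorem. -/
theorem stub_resolvent :
    ∃ cT : ℝ, 0 < cT ∧ ∀ (S : ℕ) (U : GaugeConfig 4 (2 * S + 1) (Matrix.specialUnitaryGroup (Fin 3) ℂ))
        (m₀ : ℝ) (x : TorusSite 4 (2 * S + 1)),
        let D : Matrix (TorusSite 4 (2 * S + 1) × Fin 3 × Fin 4) (TorusSite 4 (2 * S + 1) × Fin 3 × Fin 4) ℂ :=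
          wilsonDirac (fundamentalRep (Fin 3)) U m₀ 1
        let bn : Matrix (TorusSite 4 (2 * S + 1) × Fin 3 × Fin 4) (TorusSite 4 (2 * S + 1) × Fin 3 × Fin 4) ℂ →
            TorusSite 4 (2 * S + 1) → TorusSite 4 (2 * S + 1) → ℝ :=
          fun M y z => ∑ a : Fin 3, ∑ i : Fin 4, ∑ b : Fin 3, ∑ j : Fin 4, ‖M (y, a, i) (z, b, j)‖
        let side : Finset (TorusSite 4 (2 * S + 1)) →
            Matrix (TorusSite 4 (2 * S + 1) × Fin 3 × Fin 4) (TorusSite 4 (2 * S + 1) × Fin 3 × Fin 4) ℂ :=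
          fun A => Matrix.of fun p q => if p.1 ∈ A ∧ q.1 ∈ A then D p q else if p = q then 1 else 0
        let ball : ℕ → Finset (TorusSite 4 (2 * S + 1)) := fun r =>
          (box 4 r).image fun w => x + Torus.proj (2 * S + 1) w
        let sphere : ℕ → Finset (TorusSite 4 (2 * S + 1)) := fun r =>
          ((box 4 r).filter fun w : Literature.Probability.LatticeModels.Site 4 =>
              ∃ i, w i = (r : ℤ) ∨ w i = -(r : ℤ)).image
            fun w => x + Torus.proj (2 * S + 1) w
        let ebox : ℕ → Finset (TorusSite 4 (2 * S + 1)) := fun r =>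
          (Fintype.piFinset fun _ : Fin 4 => Finset.Icc (-(r : ℤ) - 1) r).image
            fun w => x + Torus.proj (2 * S + 1) w
        let boxIn : ℕ → Finset (TorusSite 4 (2 * S + 1)) := fun r =>
          ((Fintype.piFinset fun _ : Fin 4 => Finset.Icc (-(r : ℤ) - 1) r).filter
              fun w : Literature.Probability.LatticeModels.Site 4 =>
                ∃ i, w i = -(r : ℤ) - 1 ∨ w i = (r : ℤ)).image
            fun w => x + Torus.proj (2 * S + 1) w
        let boxOut : ℕ → Finset (TorusSite 4 (2 * S + 1)) := fun r =>
          ((Fintype.piFinset fun _ : Fin 4 => Finset.Icc (-(r : ℤ) - 2) (r + 1)).filter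
              fun w : Literature.Probability.LatticeModels.Site 4 =>
                ∃ i, w i = -(r : ℤ) - 2 ∨ w i = (r : ℤ) + 1).image
            fun w => x + Torus.proj (2 * S + 1) w
        (∀ r : ℕ, 1 ≤ r → r + 1 ≤ S → ∀ z : TorusSite 4 (2 * S + 1), z ∉ ball r →
          (side ((ball r)ᶜ)).det ≠ 0 →
            bn D⁻¹ x z ≤
              cT * ∑ p ∈ sphere r, ∑ p' ∈ sphere (r + 1), bn D⁻¹ x p * bn (side ((ball r)ᶜ))⁻¹ p' z) ∧
        ∀ ℓ : ℕ, 1 ≤ ℓ → ℓ + 2 ≤ S →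
          (∀ u : TorusSite 4 (2 * S + 1), u ∈ ebox ℓ → D.det ≠ 0 →
            bn (side (ebox ℓ))⁻¹ x u ≤
              bn D⁻¹ x u +
                cT * ∑ w' ∈ boxOut ℓ, ∑ w ∈ boxIn ℓ, bn D⁻¹ x w' * bn (side (ebox ℓ))⁻¹ w u) ∧
          (3 * ℓ + 4 ≤ S →
            (∀ v' y : TorusSite 4 (2 * S + 1), v' ∉ ebox (3 * ℓ + 2) → y ∉ ebox (3 * ℓ + 2) →
              D.det ≠ 0 →
                bn (side ((ebox (3 * ℓ + 2))ᶜ))⁻¹ v' y ≤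
                  bn D⁻¹ v' y +
                    cT * ∑ w' ∈ boxOut (3 * ℓ + 2), ∑ w ∈ boxIn (3 * ℓ + 2),
                      bn (side ((ebox (3 * ℓ + 2))ᶜ))⁻¹ v' w' * bn D⁻¹ w y) ∧
            (∀ y : TorusSite 4 (2 * S + 1), y ∉ ebox (3 * ℓ + 2) →
              (side (ebox ℓ)).det ≠ 0 → (side ((ebox (3 * ℓ + 2))ᶜ)).det ≠ 0 →
                bn D⁻¹ x y ≤
                  cT ^ 2 * ∑ u ∈ boxIn ℓ, ∑ u' ∈ boxOut ℓ,
                    ∑ v ∈ boxIn (3 * ℓ + 2), ∑ v' ∈ boxOut (3 * ℓ + 2),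
                      bn (side (ebox ℓ))⁻¹ x u * bn D⁻¹ u' v *
                        bn (side ((ebox (3 * ℓ + 2))ᶜ))⁻¹ v' y)) :=
  _root_.Summit.QuantumFields.QCD.Theorems.ThickCollarFarStability.stub_resolvent

/-- stub 4 (M–L; strong-coupling lower bound, the A5 corner). -/
theorem stub_unitShell : ∀ Nf : ℕ, UnitShellLowerBound Nf := by
  sorry

/-- stub 5 — CLOSED (landed p75265, `Theorems/PauliWegnerSeaFMClosureUnquenchedHopping.lean`, 308 lines:
Neumann series for both signs of `m₀ + 4`, `C = 1440`, `μ = log(41/40)`; `wilsonDirac_eq_sub_sum_wilsonHop`,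
`l2_opNorm_wilsonHop_le`, the cyclic-distance toolkit of `WilsonPropagatorHeavyMass`). Registered in unfolded
vocabulary (= `∀ Nf, HoppingDecay Nf` verbatim); the skeleton now imports the landed theorem. -/
theorem stub_hopping : ∀ Nf : ℕ,
    ∃ C μ : ℝ, 0 ≤ C ∧ 0 < μ ∧ ∀ (β : ℝ) (mq : Fin Nf → ℝ) (f : Fin Nf), (41 / 10 : ℝ) ≤ |mq f + 4| →
        ∀ (S : ℕ) (s : ℝ), 0 < s → s < 1 →
          ∀ v : Literature.Probability.LatticeModels.Site 4, v ∈ box 4 S →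
            (∫ U : GaugeConfig 4 (2 * S + 1) (Matrix.specialUnitaryGroup (Fin 3) ℂ),
                ‖(diracMatrix U mq).det‖ *
                  (∑ a : Fin 3, ∑ i : Fin 4, ∑ b : Fin 3, ∑ j : Fin 4,
                    ‖(diracMatrix U mq)⁻¹ (quarkEquiv (f, (Torus.proj (2 * S + 1) 0, a, i)))
                      (quarkEquiv (f, (Torus.proj (2 * S + 1) (v), b, j)))‖) ^ s
                ∂(wilsonMeasure (fundamentalRep (Fin 3)) β)) /
              (∫ U : GaugeConfig 4 (2 * S + 1) (Matrix.specialUnitaryGroup (Fin 3) ℂ),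
                ‖(diracMatrix U mq).det‖ ∂(wilsonMeasure (fundamentalRep (Fin 3)) β)) ≤
            C * Real.exp (-(μ * s * ‖v‖)) :=
  _root_.Summit.QuantumFields.QCD.Theorems.ThickCollarFarStability.stub_hopping

/-- stub 6 (L / open for odd `N_f`; the inward half, see `InwardExtension`). -/
theorem stub_inward :
    ∀ (Nf : ℕ) (reg : QCDRegularisation Nf) (m : Fin Nf → ℝ), (∀ f, 0 < m f) →
      InwardExtension Nf reg m := by
  sorry

/-- stub 7 (L as formalisation, M as mathematics — ASFH Thm 2/3 transplanted): from the five inputs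
and the typed `Input`, (a) lower the input's exponent to `s' = min(s, s₀, s₀')` by Jensen (ν is a
probability measure; T0), keeping room `q s₀`; (b) translation invariance of `pqE` (input at centre `0`
⇒ at every centre); (c) flavour reduction `(diracMatrix U mq)⁻¹ ↦ (wilsonD U (mq f))⁻¹` under the
weight; (d) per step `k` and flavour `f`: hopping window ⇒ `stub_hopping` (`ℓ₀' = 0`); else if
`ℓ₀(k) = 1 ∧ |β_k| ≤ β₀` ⇒ contradiction with `stub_unitShell`; else `Θ_k = ℓ₀(1+|β_k|) ≥
min(2, 1+β₀) > 1` and the bootstrap runs: conversion of the shell input into the exit moment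
(Rin + Tdec + one forward step Rfwd + Tdec), one-step same-domain subharmonicity for
`y ∉ Λ(x) = ebox(x,3ℓ₀+2)` (R2 + T1 + FarStability + Rout + Tdec) with `b_k ≤ C Θ_k^{c - θ q s₀}`,
choice of ONE `q` making `Ξ₀ b_k ≤ 1` and `b_k ≤ 1/2`, iteration ⇒ `E ≤ b_k^{‖v‖/(3ℓ₀+4)}` for
`‖v‖ ≥ 3ℓ₀+5`, the no-rate one-step bound (Rfwd + Tdec) on `ℓ₀ < ‖v‖ ≤ 3ℓ₀+4` (and on the whole
exterior when the collar does not fit), and the rate arithmetic `|log b_k|/(3ℓ₀+4) ≥ δ a_k` from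
`ℓ₀ a_k ≤ K₀(1+|log a_k|)`; (e) a.e. invertibility of the side matrices actually inverted.
Output: `OutwardDecayWith` with `ℓ₀'(k,f) ∈ {0, ℓ₀(k)}`. Held by the lead. -/
theorem stub_closure :
    ∀ (Nf : ℕ) (reg : QCDRegularisation Nf) (m : Fin Nf → ℝ), (∀ f, 0 < m f) →
      TwoStarBounds Nf → FarStability Nf → CollarResolventBounds → UnitShellLowerBound Nf →
        HoppingDecay Nf → Input Nf reg m →
          ∃ (s δ C K₀ : ℝ) (ℓ₀ : ℕ → Fin Nf → ℕ), OutwardDecayWith Nf reg m s δ C K₀ ℓ₀ := by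
  sorry

/-! ## Kernel-checked composition -/

/-- Merging the outward and inward packages at a common exponent `s` into the crux's `Conclusion`
(`δ = min`, `C = max`; pure bookkeeping, proved). -/
theorem conclusion_of_outward_inward {Nf : ℕ} (reg : QCDRegularisation Nf) (m : Fin Nf → ℝ)
    {s δ C K₀ δ' C' : ℝ} {ℓ₀ : ℕ → Fin Nf → ℕ}
    (hout : OutwardDecayWith Nf reg m s δ C K₀ ℓ₀) (hin : InwardDecayWith Nf reg m s δ' C' ℓ₀) :
    Conclusion Nf reg m := by
  obtain ⟨hs0, hs1, hδ, hC, -, -, hev⟩ := hout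
  obtain ⟨hδ', hC', hev'⟩ := hin
  refine ⟨s, min δ δ', max C C', hs0, hs1, lt_min hδ hδ', ?_⟩
  filter_upwards [hev, hev'] with k hk hk' S hS f v hv
  have ht : 0 ≤ reg.a k * ‖v‖ := mul_nonneg (reg.a_pos k).le (norm_nonneg v)
  have hmax : 0 ≤ max C C' := le_trans hC (le_max_left _ _)
  by_cases h : (ℓ₀ k f : ℝ) ≤ ‖v‖
  · calc cruxMoment Nf (reg.β k) (bareMass reg m k) S f v s
          ≤ C * Real.exp (-(δ * (reg.a k * ‖v‖))) := hk S hS f v hv h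
      _ ≤ max C C' * Real.exp (-(min δ δ' * (reg.a k * ‖v‖))) := by
          apply mul_le_mul (le_max_left _ _) _ (Real.exp_pos _).le hmax
          exact Real.exp_le_exp.mpr (neg_le_neg (mul_le_mul_of_nonneg_right (min_le_left _ _) ht))
  · have h : ‖v‖ < (ℓ₀ k f : ℝ) := lt_of_not_ge h
    calc cruxMoment Nf (reg.β k) (bareMass reg m k) S f v s
          ≤ C' * Real.exp (-(δ' * (reg.a k * ‖v‖))) := hk' S hS f v hv h
      _ ≤ max C C' * Real.exp (-(min δ δ' * (reg.a k * ‖v‖))) := by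
          apply mul_le_mul (le_max_right _ _) _ (Real.exp_pos _).le hmax
          exact Real.exp_le_exp.mpr (neg_le_neg (mul_le_mul_of_nonneg_right (min_le_right _ _) ht))

/-- **Composition.** The seven stub statements imply the crux BY NAME. Pure logic after the defeq
`crux_iff`: the closure turns (two-star, far stability, resolvent algebra, unit-shell corner, hopping
window, input) into the outward package, the inward stub supplies the complementary package at the
same exponent, and `conclusion_of_outward_inward` merges them. K1 and K3 (the crux's own hypotheses)
are consumed by `stub_twoStar`. -/
theorem FMClosureUnquenched_of :
    (Summit.QuantumFields.QCD.Theses.PauliWegnerSea.FibreCofactorDomination →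
      Summit.QuantumFields.QCD.Theses.PauliWegnerSea.TiltedFlatness → ∀ Nf : ℕ, TwoStarBounds Nf) →
    (Summit.QuantumFields.QCD.Theses.PauliWegnerSea.FibreCofactorDomination →
      Summit.QuantumFields.QCD.Theses.PauliWegnerSea.TiltedFlatness → ∀ Nf : ℕ, FarStability Nf) →
    CollarResolventBounds →
    (∀ Nf : ℕ, UnitShellLowerBound Nf) →
    (∀ Nf : ℕ, HoppingDecay Nf) →
    (∀ (Nf : ℕ) (reg : QCDRegularisation Nf) (m : Fin Nf → ℝ), (∀ f, 0 < m f) →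
      InwardExtension Nf reg m) →
    (∀ (Nf : ℕ) (reg : QCDRegularisation Nf) (m : Fin Nf → ℝ), (∀ f, 0 < m f) →
      TwoStarBounds Nf → FarStability Nf → CollarResolventBounds → UnitShellLowerBound Nf →
        HoppingDecay Nf → Input Nf reg m →
          ∃ (s δ C K₀ : ℝ) (ℓ₀ : ℕ → Fin Nf → ℕ), OutwardDecayWith Nf reg m s δ C K₀ ℓ₀) →
    Summit.QuantumFields.QCD.Theses.PauliWegnerSea.FMClosureUnquenched := by
  intro h1 h2 h3 h4 h5 h6 h7
  rw [crux_iff]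
  intro hK1 hK3 Nf reg m hm hin
  obtain ⟨s, δ, C, K₀, ℓ₀, hout⟩ := h7 Nf reg m hm (h1 hK1 hK3 Nf) (h2 hK1 hK3 Nf) h3 (h4 Nf) (h5 Nf) hin
  obtain ⟨δ', C', hinw⟩ := h6 Nf reg m hm (h1 hK1 hK3 Nf) hin s δ C K₀ ℓ₀ hout
  exact conclusion_of_outward_inward reg m hout hinw

/-- The composition instantiated with the registered stubs (so that, once every `stub_*` is proved,
this very term closes the crux). `stub_resolvent` / `stub_hopping` are consumed at the packaged
types `CollarResolventBounds` / `∀ Nf, HoppingDecay Nf` by `δ`-unfolding. -/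
theorem FMClosureUnquenched_of_stubs :
    Summit.QuantumFields.QCD.Theses.PauliWegnerSea.FMClosureUnquenched :=
  FMClosureUnquenched_of stub_twoStar stub_farStability stub_resolvent stub_unitShell stub_hopping
    stub_inward stub_closure

end Summit.QuantumFields.QCD.Cruxes.FMClosureUnquenched.ThickCollarFarStability
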